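import Summits.AnomalousDissipation.AnomalousDissipation.Theorems.SoloBlindUnpinningLH
import Literature.Analysis.FunctionSpaces.TorusLinearisedNSEnergy

/-!
# Solo (blind) — the Reynolds-stress identity for a general steady force

The Kolmogorov-force files (`SoloBlindZerothLawPinning`, `SoloBlindUnpinningLH`) read the mean
injected power of a Leray–Hopf solution off ONE large-scale quadratic moment. Here the force is
arbitrary: `f : 𝕋³ → ℝ³` smooth with zero mean, and `Ψ` is any smooth divergence-free field with
`ΔΨ = −λ f`, `λ > 0` (a "potential" of the force: `Ψ = f`, `λ = 4π²|k|²` for a single-shell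
force; `Ψ = λ(−Δ)⁻¹f` in general). Testing the time-sliced weak formulation
(`Torus.IsLerayHopfOn.integral_inner_eq_add_setIntegral`) with `Ψ` gives, slice by slice,
`d/dt ⟨u,Ψ⟩ = A − νλ W + Γ` with the REYNOLDS-STRESS MOMENT `A(t) = ∫⟪u, (u·∇)Ψ⟫ = ∫ u⊗u : ∇Ψ`,
the injected power `W(t) = ∫⟪f,u⟫` and the constant `Γ = ∫⟪f,Ψ⟫ = ‖∇Ψ‖²/λ`
(`lam_mul_forcePairing_eq_gradNormSq`). This file proves, along every global Leray–Hopf solution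
of `NS_ν(f)` on `𝕋³`:

* `lh_pairing_eq`: `∫⟪u(t),Ψ⟫ = ∫⟪u₀,Ψ⟫ + ∫_{(0,t]} (A − νλW + Γ)`;
* `stress_window_eq` (exact, every `T > 0`): `νλ⟨W⟩_T = Γ + ⟨A⟩_T − T⁻¹(∫⟪u(T),Ψ⟫ − ∫⟪u₀,Ψ⟫)`;
* `eventually_abs_stressBoundary_le` / `tendsto_stressBoundary` (`ν > 0`): the boundary term is
  `o(1)` with NO hypothesis on the datum or on uniform-in-time energy (Leray–Hopf energy
  inequality `‖u(T)‖² ≤ ‖u₀‖² + 2T⟨W⟩_T` and the Doering–Foias Cesàro bounds);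
* `eventually_stressMean_crude_bounds`: the Cesàro means `⟨A⟩_T` are eventually bounded.

The `limsup` consequences (exact formula for `meanPower`, pinning window, doors to `ZerothLaw`)
are in `SoloBlindStressPinning`.
[folklore; cite: DoeringFoias2002, §2; cite: Temam1984, Ch. III §1.1 (1.25)]
-/


open MeasureTheory Filter Topology Set UnitAddTorus
open scoped ENNReal NNReal InnerProductSpace

noncomputable section

namespace Summit.AnomalousDissipation.AnomalousDissipation.Theorems

open Literature.Analysis.FunctionSpaces Literature.Analysis.FunctionSpaces.Torus
open Literature.Analysis.FluidPDE

variable {ν lam T : ℝ} {f Ψ u₀ : UnitAddTorus (Fin 3) → EuclideanSpace ℝ (Fin 3)}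
  {u : ℝ → UnitAddTorus (Fin 3) → EuclideanSpace ℝ (Fin 3)}

/-! ### The moments -/

/-- The Reynolds-stress moment `A(t) = ∫⟪u(t), (u(t)·∇)Ψ⟫ = ∫ u⊗u : ∇Ψ` against a test field `Ψ`.
[folklore] -/
def stressMoment (Ψ : UnitAddTorus (Fin 3) → EuclideanSpace ℝ (Fin 3))
    (u : ℝ → UnitAddTorus (Fin 3) → EuclideanSpace ℝ (Fin 3)) : ℝ → ℝ :=
  fun t => ∫ x, ⟪u t x, Torus.convect (u t) Ψ x⟫_ℝ

/-- The Cesàro means `⟨A⟩_T` of the Reynolds-stress moment. [folklore] -/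
def stressMean (Ψ : UnitAddTorus (Fin 3) → EuclideanSpace ℝ (Fin 3))
    (u : ℝ → UnitAddTorus (Fin 3) → EuclideanSpace ℝ (Fin 3)) : ℝ → ℝ :=
  timeMean (stressMoment Ψ u)

/-- The Cesàro means `⟨W⟩_T` of the injected power `W(t) = ∫⟪f, u(t)⟫` (`meanPower f u` is their
`limsup`). [folklore] -/
def forcePowerMean (f : UnitAddTorus (Fin 3) → EuclideanSpace ℝ (Fin 3))
    (u : ℝ → UnitAddTorus (Fin 3) → EuclideanSpace ℝ (Fin 3)) : ℝ → ℝ :=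
  timeMean fun t => ∫ x, ⟪f x, u t x⟫_ℝ

/-- **`λ ∫⟪f,Ψ⟫ = ‖∇Ψ‖²`** when `ΔΨ = −λf` (Green's first identity,
`Torus.integral_inner_laplacian_self_eq_neg_gradNormSq_of_isSmooth`): the constant `Γ = ∫⟪f,Ψ⟫`
of the stress identity is `‖∇Ψ‖²/λ ≥ 0`. [folklore] -/
theorem lam_mul_forcePairing_eq_gradNormSq (hΨ : IsSmooth Ψ)
    (hΨf : ∀ x, Torus.laplacian Ψ x = -lam • f x) :
    lam * ∫ x, ⟪f x, Ψ x⟫_ℝ = gradNormSq Ψ := by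
  have h := integral_inner_laplacian_self_eq_neg_gradNormSq_of_isSmooth hΨ
  simp_rw [hΨf, real_inner_smul_left] at h
  rw [integral_const_mul] at h
  linarith

/-- `0 ≤ ∫⟪f,Ψ⟫` when `ΔΨ = −λf`, `λ > 0`. [folklore] -/
theorem forcePairing_nonneg (hΨ : IsSmooth Ψ) (hlam : 0 < lam)
    (hΨf : ∀ x, Torus.laplacian Ψ x = -lam • f x) : 0 ≤ ∫ x, ⟪f x, Ψ x⟫_ℝ := by
  have h := lam_mul_forcePairing_eq_gradNormSq hΨ hΨf
  have h0 : 0 ≤ gradNormSq Ψ := gradNormSq_nonneg _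
  nlinarith

/-! ### The slice identity for `L²` fields -/

/-- `∫⟪U, ΔΨ⟫ = −λ ∫⟪f, U⟫` when `ΔΨ = −λf`. [folklore] -/
theorem integral_inner_laplacian_eq_of_potential
    (hΨf : ∀ x, Torus.laplacian Ψ x = -lam • f x)
    (U : UnitAddTorus (Fin 3) → EuclideanSpace ℝ (Fin 3)) :
    ∫ x, ⟪U x, Torus.laplacian Ψ x⟫_ℝ = -lam * ∫ x, ⟪f x, U x⟫_ℝ := by
  rw [← integral_const_mul]
  refine integral_congr_ae (ae_of_all _ fun x => ?_)
  dsimp only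
  rw [hΨf, real_inner_smul_right, real_inner_comm]

/-- The flux integrand of an `L²` slice against `Ψ` (`ΔΨ = −λf`):
`∫ (⟪U,(U·∇)Ψ⟫ + ν⟪U,ΔΨ⟫ + ⟪f,Ψ⟫) = ∫⟪U,(U·∇)Ψ⟫ − νλ ∫⟪f,U⟫ + ∫⟪f,Ψ⟫`. [folklore] -/
theorem sliceFlux_potential {U : UnitAddTorus (Fin 3) → EuclideanSpace ℝ (Fin 3)}
    (hU : MemLp U 2 volume) (hf : IsSmooth f) (hΨ : IsSmooth Ψ)
    (hΨf : ∀ x, Torus.laplacian Ψ x = -lam • f x) (ν : ℝ) :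
    ∫ x, (⟪U x, Torus.convect U Ψ x⟫_ℝ + ν * ⟪U x, Torus.laplacian Ψ x⟫_ℝ + ⟪f x, Ψ x⟫_ℝ) =
      (∫ x, ⟪U x, Torus.convect U Ψ x⟫_ℝ) - ν * lam * (∫ x, ⟪f x, U x⟫_ℝ) +
        ∫ x, ⟪f x, Ψ x⟫_ℝ := by
  have h1 : Integrable (fun x => ⟪U x, Torus.convect U Ψ x⟫_ℝ) volume :=
    Torus.integrable_inner_convect_self hU hΨ
  have h2 : Integrable (fun x => ν * ⟪U x, Torus.laplacian Ψ x⟫_ℝ) volume :=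
    (Torus.integrable_inner_of_continuous (hU.integrable one_le_two)
      hΨ.laplacian.continuous).const_mul ν
  have h3 : Integrable (fun x => ⟪f x, Ψ x⟫_ℝ) volume :=
    Torus.integrable_inner_of_continuous hf.integrable hΨ.continuous
  have h12 : Integrable (fun x => ⟪U x, Torus.convect U Ψ x⟫_ℝ +
      ν * ⟪U x, Torus.laplacian Ψ x⟫_ℝ) volume := h1.add h2
  rw [integral_add h12 h3, integral_add h1 h2, integral_const_mul,
    integral_inner_laplacian_eq_of_potential hΨf]
  ring

/-! ### Along a Leray–Hopf weak solution on `[0, T]` -/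

/-- **The stress identity along a Leray–Hopf weak solution**: for `t ∈ (0, T]`,
`∫⟪u(t),Ψ⟫ = ∫⟪u₀,Ψ⟫ + ∫_{(0,t]} (A(s) − νλ W(s) + Γ) ds`.
[folklore; cite: Temam1984, Ch. III §1.1 (1.25)] -/
theorem lh_pairing_eq (h : Torus.IsLerayHopfOn T ν (fun _ => f) u₀ u) (hT : 0 < T)
    (hf : IsSmooth f) (hΨ : IsSmooth Ψ) (hΨdiv : IsDivFree Ψ)
    (hΨf : ∀ x, Torus.laplacian Ψ x = -lam • f x) {t : ℝ} (ht : t ∈ Ioc 0 T) :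
    ∫ x, ⟪u t x, Ψ x⟫_ℝ = (∫ x, ⟪u₀ x, Ψ x⟫_ℝ) + ∫ s in Ioc 0 t,
      (stressMoment Ψ u s - ν * lam * (∫ x, ⟪f x, u s x⟫_ℝ) + ∫ x, ⟪f x, Ψ x⟫_ℝ) := by
  have key := h.integral_inner_eq_add_setIntegral hT
    (Literature.Analysis.FluidPDE.aestronglyMeasurable_stLift_steady hf.continuous _)
    (Literature.Analysis.FluidPDE.lintegral_Ioo_lintegral_enorm_sq_steady_lt_top (hf.memLp 2) T)
    hΨ hΨdiv ht
  rw [key]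
  congr 1
  refine setIntegral_congr_fun measurableSet_Ioc fun s hs => ?_
  exact sliceFlux_potential (h.memLp s ⟨hs.1.le, hs.2.trans ht.2⟩) hf hΨ hΨf ν

/-- The power `s ↦ ∫⟪f, u(s)⟫` is integrable on `(0, T)`. [folklore] -/
theorem lh_integrableOn_power (h : Torus.IsLerayHopfOn T ν (fun _ => f) u₀ u)
    (hf : IsSmooth f) : IntegrableOn (fun s => ∫ x, ⟪f x, u s x⟫_ℝ) (Ioo 0 T) :=
  (h.integrableOn_integral_inner hf.continuous).congr_fun
    (fun s _ => integral_inner_comm' f (u s)) measurableSet_Ioo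

/-- The Reynolds-stress moment `s ↦ A(s)` is integrable on `(0, T)`. [folklore] -/
theorem lh_integrableOn_stressMoment (h : Torus.IsLerayHopfOn T ν (fun _ => f) u₀ u)
    (hf : IsSmooth f) (hΨ : IsSmooth Ψ) (hΨf : ∀ x, Torus.laplacian Ψ x = -lam • f x) :
    IntegrableOn (stressMoment Ψ u) (Ioo 0 T) := by
  have hFl := h.integrableOn_flux
    (Literature.Analysis.FluidPDE.aestronglyMeasurable_stLift_steady hf.continuous _)
    (Literature.Analysis.FluidPDE.lintegral_Ioo_lintegral_enorm_sq_steady_lt_top (hf.memLp 2) T)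
    hΨ
  have hW := lh_integrableOn_power h hf
  haveI : IsFiniteMeasure (volume.restrict (Ioo (0 : ℝ) T)) :=
    ⟨by rw [Measure.restrict_apply_univ]; exact measure_Ioo_lt_top⟩
  have hc : IntegrableOn (fun _ : ℝ => ∫ x, ⟪f x, Ψ x⟫_ℝ) (Ioo 0 T) := integrable_const _
  have hsum : IntegrableOn (fun s =>
      (∫ x, (⟪u s x, Torus.convect (u s) Ψ x⟫_ℝ + ν * ⟪u s x, Torus.laplacian Ψ x⟫_ℝ +
        ⟪f x, Ψ x⟫_ℝ)) + ν * lam * (∫ x, ⟪f x, u s x⟫_ℝ) - ∫ x, ⟪f x, Ψ x⟫_ℝ) (Ioo 0 T) :=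
    (hFl.add (hW.const_mul (ν * lam))).sub hc
  refine hsum.congr_fun (fun s hs => ?_) measurableSet_Ioo
  dsimp only
  rw [sliceFlux_potential (h.memLp s (Ioo_subset_Icc_self hs)) hf hΨ hΨf ν]
  unfold stressMoment
  ring

/-! ### Along a global Leray–Hopf weak solution -/

/-- **The Cesàro stress identity with its boundary term** (`T > 0`):
`νλ ⟨W⟩_T = Γ + ⟨A⟩_T − T⁻¹ (∫⟪u(T),Ψ⟫ − ∫⟪u₀,Ψ⟫)`. [folklore] -/
theorem stress_window_eq (hu : Torus.IsGlobalLerayHopf ν (fun _ => f) u₀ u)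
    (hf : IsSmooth f) (hΨ : IsSmooth Ψ) (hΨdiv : IsDivFree Ψ)
    (hΨf : ∀ x, Torus.laplacian Ψ x = -lam • f x) (hT : 0 < T) :
    ν * lam * forcePowerMean f u T =
      (∫ x, ⟪f x, Ψ x⟫_ℝ) + stressMean Ψ u T -
        T⁻¹ * ((∫ x, ⟪u T x, Ψ x⟫_ℝ) - ∫ x, ⟪u₀ x, Ψ x⟫_ℝ) := by
  have h := hu T hT
  have hA := integrableOn_Ioc_of_Ioo (lh_integrableOn_stressMoment h hf hΨ hΨf) le_rfl
  have hW := integrableOn_Ioc_of_Ioo (lh_integrableOn_power h hf) le_rfl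
  have hII := lh_pairing_eq h hT hf hΨ hΨdiv hΨf ⟨hT, le_rfl⟩
  haveI : IsFiniteMeasure (volume.restrict (Ioc (0 : ℝ) T)) :=
    ⟨by rw [Measure.restrict_apply_univ]; exact measure_Ioc_lt_top⟩
  have hc : IntegrableOn (fun _ : ℝ => ∫ x, ⟪f x, Ψ x⟫_ℝ) (Ioc 0 T) := integrable_const _
  have i1 : IntegrableOn (fun s => stressMoment Ψ u s - ν * lam * ∫ x, ⟪f x, u s x⟫_ℝ)
      (Ioc 0 T) := hA.sub (hW.const_mul _)
  rw [integral_add i1 hc, integral_sub hA (hW.const_mul _),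
    integral_const_mul, setIntegral_const, Real.volume_real_Ioc_of_le hT.le, sub_zero,
    smul_eq_mul] at hII
  have hTinv : T⁻¹ * T = 1 := inv_mul_cancel₀ hT.ne'
  unfold forcePowerMean stressMean timeMean
  rw [intervalIntegral.integral_of_le hT.le, intervalIntegral.integral_of_le hT.le]
  linear_combination T⁻¹ * hII + (∫ x, ⟪f x, Ψ x⟫_ℝ) * hTinv

/-- Cauchy–Schwarz for a pairing of an `L²` slice with a smooth field:
`|∫⟪U, Ψ⟫| ≤ √(∫‖Ψ‖²) √(∫‖U‖²)`. [folklore] -/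
theorem abs_pairing_le_L2 {U : UnitAddTorus (Fin 3) → EuclideanSpace ℝ (Fin 3)}
    (hU : MemLp U 2 volume) (hΨ : IsSmooth Ψ) :
    |∫ x, ⟪U x, Ψ x⟫_ℝ| ≤ Real.sqrt (∫ x, ‖Ψ x‖ ^ 2) * Real.sqrt (∫ x, ‖U x‖ ^ 2) := by
  have hE : Integrable (fun x => ‖Ψ x‖ ^ 2) volume :=
    (hΨ.memLp 2).integrable_norm_pow two_ne_zero
  have hL : Integrable (fun x => ‖U x‖ ^ 2) volume := hU.integrable_norm_pow two_ne_zero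
  have hi : Integrable (fun x => ⟪U x, Ψ x⟫_ℝ) volume :=
    Torus.integrable_inner_of_continuous (hU.integrable one_le_two) hΨ.continuous
  have hG : AEStronglyMeasurable (fun x => |⟪U x, Ψ x⟫_ℝ|) volume :=
    hi.abs.aestronglyMeasurable
  rw [← Real.sqrt_mul (integral_nonneg fun x => sq_nonneg _)]
  refine abs_integral_le_integral_abs.trans
    (integral_le_sqrt_integral_mul_integral (ae_of_all _ fun x => abs_nonneg _)
      (ae_of_all _ fun x => sq_nonneg _) (ae_of_all _ fun x => sq_nonneg _)
      (ae_of_all _ fun x => ?_) hG hE hL)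
  dsimp only
  rw [← mul_pow]
  exact pow_le_pow_left₀ (abs_nonneg _)
    ((abs_real_inner_le_norm _ _).trans_eq (mul_comm _ _)) 2

/-- Slice energy from the Leray–Hopf energy inequality: `∫‖u(T)‖² ≤ ∫‖u₀‖² + 2T·⟨W⟩_T`
(`T > 0`, `ν ≥ 0`). [folklore; cite: Leray1934, (5.2)] -/
theorem lh_norm_sq_le_general (hu : Torus.IsGlobalLerayHopf ν (fun _ => f) u₀ u) (hν : 0 ≤ ν)
    (hT : 0 < T) :
    ∫ x, ‖u T x‖ ^ 2 ≤ (∫ x, ‖u₀ x‖ ^ 2) + 2 * T * forcePowerMean f u T := by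
  have h := (hu T hT).energy_ineq_zero T ⟨hT.le, le_rfl⟩
  simp only [Torus.kineticEnergy] at h
  have hD : 0 ≤ ν * (∫⁻ τ in Ioo 0 T, Torus.eGradNormSq (u τ)).toReal :=
    mul_nonneg hν ENNReal.toReal_nonneg
  have hP : ∫ τ in (0 : ℝ)..T, ∫ x, ⟪f x, u τ x⟫_ℝ = T * forcePowerMean f u T := by
    unfold forcePowerMean timeMean
    rw [← mul_assoc, mul_inv_cancel₀ hT.ne', one_mul]
  linarith

/-- Cesàro power against Cesàro energy: `|⟨W⟩_T| ≤ ‖f‖_{L²} √⟨‖u‖²⟩_T` (the tree's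
`Torus.IsGlobalLerayHopf.abs_timeMean_power_le`). [cite: DoeringFoias2002, §2] -/
theorem abs_forcePowerMean_le (hu : Torus.IsGlobalLerayHopf ν (fun _ => f) u₀ u)
    (hf : IsSmooth f) (hT : 0 < T) :
    |forcePowerMean f u T| ≤ Real.sqrt (∫ x, ‖f x‖ ^ 2) * Real.sqrt (energyMean u T) :=
  hu.abs_timeMean_power_le hf hT

/-- Doering–Foias Cesàro energy bound (`ν > 0`): `⟨‖u‖²⟩_T ≤ K` for all `T ≥ 1` (the tree's
`Torus.IsGlobalLerayHopf.timeMean_norm_sq_le`). [cite: DoeringFoias2002, §2] -/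
theorem exists_energyMean_le_general (hu : Torus.IsGlobalLerayHopf ν (fun _ => f) u₀ u)
    (hν : 0 < ν) (hf : IsSmooth f) (hf0 : HasZeroMean f) :
    ∃ K : ℝ, 0 ≤ K ∧ ∀ T, 1 ≤ T → energyMean u T ≤ K := by
  refine ⟨Torus.kineticEnergy u₀ / (2 * Real.pi ^ 2 * ν) +
    (2 * ‖∫ x, u 1 x‖ ^ 2 + (∫ x, ‖f x‖ ^ 2) / (16 * Real.pi ^ 4 * ν ^ 2)), ?_,
    fun T hT => hu.timeMean_norm_sq_le hν hf hf0 hT⟩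
  have h1 : 0 ≤ Torus.kineticEnergy u₀ := Torus.kineticEnergy_nonneg _
  have h2 : 0 ≤ ∫ x, ‖f x‖ ^ 2 := integral_nonneg fun _ => by positivity
  positivity

/-- **The boundary term of the Cesàro stress identity vanishes**: for every `δ > 0`, eventually
`T⁻¹ |∫⟪u(T),Ψ⟫ − ∫⟪u₀,Ψ⟫| ≤ δ`, along every global Leray–Hopf solution (`ν > 0`; no hypothesis
on the datum, no uniform-in-time energy hypothesis: `‖u(T)‖² ≤ ‖u₀‖² + O(T)`). [folklore] -/
theorem eventually_abs_stressBoundary_le (hu : Torus.IsGlobalLerayHopf ν (fun _ => f) u₀ u)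
    (hν : 0 < ν) (hf : IsSmooth f) (hf0 : HasZeroMean f) (hΨ : IsSmooth Ψ) {δ : ℝ}
    (hδ : 0 < δ) :
    ∀ᶠ T : ℝ in atTop,
      |T⁻¹ * ((∫ x, ⟪u T x, Ψ x⟫_ℝ) - ∫ x, ⟪u₀ x, Ψ x⟫_ℝ)| ≤ δ := by
  obtain ⟨K, hK0, hK⟩ := exists_energyMean_le_general hu hν hf hf0
  set Fn : ℝ := Real.sqrt (∫ x, ‖f x‖ ^ 2) with hFn
  set Pn : ℝ := Real.sqrt (∫ x, ‖Ψ x‖ ^ 2) with hPn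
  set a : ℝ := ∫ x, ‖u₀ x‖ ^ 2 with ha_def
  set w₀ : ℝ := |∫ x, ⟪u₀ x, Ψ x⟫_ℝ| with hw₀
  set c : ℝ := 2 * (Fn * Real.sqrt K) with hc_def
  have hFn0 : 0 ≤ Fn := Real.sqrt_nonneg _
  have hPn0 : 0 ≤ Pn := Real.sqrt_nonneg _
  have ha : 0 ≤ a := integral_nonneg fun _ => by positivity
  have hc : 0 ≤ c := by positivity
  have hw : 0 ≤ w₀ := abs_nonneg _
  have h1 : ∀ᶠ T : ℝ in atTop, w₀ ≤ δ / 2 * T := by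
    filter_upwards [eventually_ge_atTop (2 * w₀ / δ)] with T hT
    calc w₀ = δ / 2 * (2 * w₀ / δ) := by field_simp
      _ ≤ δ / 2 * T := mul_le_mul_of_nonneg_left hT (by positivity)
  have h2 : ∀ᶠ T : ℝ in atTop, Pn * Real.sqrt (a + c * T) ≤ δ / 2 * T := by
    filter_upwards [eventually_ge_atTop (1 : ℝ),
      eventually_ge_atTop (Pn ^ 2 * (a + c) / (δ / 2) ^ 2)] with T hT1 hT2
    have hT0 : 0 ≤ T := zero_le_one.trans hT1
    have h3 : Pn ^ 2 * (a + c) ≤ (δ / 2) ^ 2 * T := by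
      have h := mul_le_mul_of_nonneg_left hT2 (by positivity : (0 : ℝ) ≤ (δ / 2) ^ 2)
      rwa [mul_div_cancel₀ _ (by positivity : ((δ : ℝ) / 2) ^ 2 ≠ 0)] at h
    have hsq : Pn ^ 2 * (a + c * T) ≤ (δ / 2 * T) ^ 2 := by
      nlinarith [mul_nonneg (sub_nonneg.2 hT1) (mul_nonneg (sq_nonneg Pn) ha),
        mul_nonneg hT0 (sub_nonneg.2 h3)]
    calc Pn * Real.sqrt (a + c * T) = Real.sqrt (Pn ^ 2) * Real.sqrt (a + c * T) := by
          rw [Real.sqrt_sq hPn0]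
      _ = Real.sqrt (Pn ^ 2 * (a + c * T)) := (Real.sqrt_mul (sq_nonneg _) _).symm
      _ ≤ Real.sqrt ((δ / 2 * T) ^ 2) := Real.sqrt_le_sqrt hsq
      _ = δ / 2 * T := Real.sqrt_sq (by positivity)
  filter_upwards [h1, h2, eventually_gt_atTop (0 : ℝ), eventually_ge_atTop (1 : ℝ)]
    with T i1 i2 hT hT1
  have hE : ∫ x, ‖u T x‖ ^ 2 ≤ a + c * T := by
    have h := lh_norm_sq_le_general hu hν.le hT
    have hp : forcePowerMean f u T ≤ Fn * Real.sqrt K :=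
      (le_abs_self _).trans ((abs_forcePowerMean_le hu hf hT).trans
        (mul_le_mul_of_nonneg_left (Real.sqrt_le_sqrt (hK T hT1)) hFn0))
    have h' := mul_le_mul_of_nonneg_left hp (by positivity : (0 : ℝ) ≤ 2 * T)
    rw [hc_def]
    linarith
  have hW : |∫ x, ⟪u T x, Ψ x⟫_ℝ| ≤ Pn * Real.sqrt (a + c * T) :=
    (abs_pairing_le_L2 ((hu T hT).memLp T ⟨hT.le, le_rfl⟩) hΨ).trans
      (mul_le_mul_of_nonneg_left (Real.sqrt_le_sqrt hE) hPn0)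
  have hA1 := le_abs_self (∫ x, ⟪u T x, Ψ x⟫_ℝ)
  have hA2 := neg_abs_le (∫ x, ⟪u T x, Ψ x⟫_ℝ)
  have hB1 := le_abs_self (∫ x, ⟪u₀ x, Ψ x⟫_ℝ)
  have hB2 := neg_abs_le (∫ x, ⟪u₀ x, Ψ x⟫_ℝ)
  have hW2 := hW.trans i2
  have hdiff : |(∫ x, ⟪u T x, Ψ x⟫_ℝ) - ∫ x, ⟪u₀ x, Ψ x⟫_ℝ| ≤ δ / 2 * T + δ / 2 * T :=
    abs_sub_le_iff.2 ⟨by linarith, by linarith⟩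
  have hTinv : T⁻¹ * T = 1 := inv_mul_cancel₀ hT.ne'
  rw [abs_mul, abs_of_pos (inv_pos.2 hT)]
  calc T⁻¹ * |(∫ x, ⟪u T x, Ψ x⟫_ℝ) - ∫ x, ⟪u₀ x, Ψ x⟫_ℝ|
      ≤ T⁻¹ * (δ / 2 * T + δ / 2 * T) := mul_le_mul_of_nonneg_left hdiff (inv_pos.2 hT).le
    _ = δ := by linear_combination δ * hTinv

/-- The boundary term tends to zero. [folklore] -/
theorem tendsto_stressBoundary (hu : Torus.IsGlobalLerayHopf ν (fun _ => f) u₀ u)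
    (hν : 0 < ν) (hf : IsSmooth f) (hf0 : HasZeroMean f) (hΨ : IsSmooth Ψ) :
    Tendsto (fun T : ℝ => T⁻¹ * ((∫ x, ⟪u T x, Ψ x⟫_ℝ) - ∫ x, ⟪u₀ x, Ψ x⟫_ℝ))
      atTop (𝓝 0) := by
  rw [Metric.tendsto_nhds]
  intro δ hδ
  filter_upwards [eventually_abs_stressBoundary_le hu hν hf hf0 hΨ (half_pos hδ)] with T hT
  rw [Real.dist_eq, sub_zero]
  exact hT.trans_lt (half_lt_self hδ)

/-- Eventual crude bounds (`ν > 0`): for all large `T`, `|⟨W⟩_T| ≤ C` and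
`|⟨A⟩_T + Γ| ≤ νλC + 1`. [folklore] -/
theorem eventually_stressMean_crude_bounds (hu : Torus.IsGlobalLerayHopf ν (fun _ => f) u₀ u)
    (hν : 0 < ν) (hf : IsSmooth f) (hf0 : HasZeroMean f) (hΨ : IsSmooth Ψ)
    (hΨdiv : IsDivFree Ψ) (hlam : 0 < lam) (hΨf : ∀ x, Torus.laplacian Ψ x = -lam • f x) :
    ∃ C : ℝ, ∀ᶠ T : ℝ in atTop, |forcePowerMean f u T| ≤ C ∧
      |stressMean Ψ u T + ∫ x, ⟪f x, Ψ x⟫_ℝ| ≤ ν * lam * C + 1 := by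
  obtain ⟨K, hK0, hK⟩ := exists_energyMean_le_general hu hν hf hf0
  refine ⟨Real.sqrt (∫ x, ‖f x‖ ^ 2) * Real.sqrt K, ?_⟩
  have hνl : 0 < ν * lam := mul_pos hν hlam
  filter_upwards [eventually_ge_atTop (1 : ℝ),
    eventually_abs_stressBoundary_le hu hν hf hf0 hΨ one_pos] with T hT1 hb
  have hT : 0 < T := by linarith
  have hp : |forcePowerMean f u T| ≤ Real.sqrt (∫ x, ‖f x‖ ^ 2) * Real.sqrt K :=
    (abs_forcePowerMean_le hu hf hT).trans
      (mul_le_mul_of_nonneg_left (Real.sqrt_le_sqrt (hK T hT1)) (Real.sqrt_nonneg _))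
  refine ⟨hp, ?_⟩
  have e := stress_window_eq hu hf hΨ hΨdiv hΨf hT
  obtain ⟨p1, p2⟩ := abs_le.1 hp
  obtain ⟨b1, b2⟩ := abs_le.1 hb
  have q1 := mul_le_mul_of_nonneg_left p1 hνl.le
  have q2 := mul_le_mul_of_nonneg_left p2 hνl.le
  rw [abs_le]
  constructor <;> linarith

end Summit.AnomalousDissipation.AnomalousDissipation.Theorems

end
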